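import Summits.HodgeConjecture.HodgeConjecture.Theorems.Ring2AbelianAllAndrePrimitiveLiftFibreLefschetzDegree
import HarnessLib

/-!
# Ring 2 · sub-cell AbelianAll (ALL ABELIAN VARIETIES), André axis, part XXIII-h — WHAT THE FIBRE-SUPPORTED CLAUSE ASKS OF THE TOTAL SPACE:
# the hard-Lefschetz preimage `x = (L_K^{m+1})⁻¹ j_{t*} L_κᵐ ξ` of a (rational) `κ`-primitive (p+1,p+1)-class `ξ` of the fibre is a
# (rational) `K`-PRIMITIVE HODGE CLASS of type `(p+1, p+1)` on the `(d+1)`-fold `𝒳` — so part XXIII-f's clause is the Hodge conjecture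
# for finitely many explicit primitive Hodge classes of the total space

HONEST FRAMING (page 1, verbatim): **research route, not a corollary; conditional on HC_CM plus one named
minimal statement.** Cell line: research route conditional on HC_CM; not a corollary; Q11.4-sentence-2
already refuted in dim ≥ 3. Nothing in this file proves a case of the Hodge conjecture for an abelian variety; `HC_CM` does not occur in
this file; item `Theses.RankFourFaces.CMToAbelian` (stmt-16267) OPEN and not closed here. Seat `pub-hodge-ring2-ab-andre-2`, gen 15; brief
(iii) "smallest open instance stated as a find-the-cycle problem".

## What is proved (theorems only; no definition, no named fact, no sorry)

For a compact pencil `f : 𝒳 ⟶ S` of abelian `d`-folds, a point `t`, `2(p+1) + m = d`, a class `ξ ∈ H^{2p+2}(X_t)` and a class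
`x ∈ H^{2p+2}(𝒳)` with `L_K^{m+1} x = j_{t*}(L_κᵐ ξ)` (`K` a class on `𝒳`, `κ = j_t^*K`; for `K = D.Hη` such an `x` exists and is unique
by hard Lefschetz):
* **`hardLefschetz_preimage_fiberGysin_primitive`** — if `ξ` is `κ`-primitive then `L_K^{m+2} x = 0` (`x` is `K`-PRIMITIVE; any `K`);
* **`hardLefschetz_preimage_fiberGysin_hodgeType`** — if `ξ` is of Hodge type `(p+1, p+1)` then so is `x` (`K = D.Hη`: the off-diagonal type
  projectors pass through `L_κᵐ`, `j_{t*}` (part XXIII-a) and `L_K^{m+1}`, injective);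
* **`hardLefschetz_preimage_fiberGysin_rational`** — if `ξ` is rational then so is `x` (`K = D.Hη`: `j_{t*}`, `L_κᵐ` preserve rational
  classes and the hard Lefschetz isomorphism of the rational Kähler class is defined over `ℚ`).

READING (RING2-MAP §AbelianAll gen 15). Part XXIII-f reduced the André-axis primitive lift (Prim)_t(p+1) — given the lift one degree below —
to: `x_ξ := (L_K^{m+1})⁻¹ j_{t*} L_κᵐ ξ ∈ N^{p+1}(𝒳)` for the `κ`-primitive invariant algebraic classes `ξ` of ONE fibre. By this file, for
rational such `ξ` the class `x_ξ` is a rational `K`-primitive Hodge class of type `(p+1,p+1)` on the total space: THE CLAUSE IS THE HODGE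
CONJECTURE OF THE `(d+1)`-FOLD `𝒳` FOR THESE EXPLICIT PRIMITIVE CLASSES (at most `dim P^{2p+2}(X_t) ∩ N^{p+1}(X_t) ∩ Im j_t^*` of them). For
the W₆ habitat (sevenfold total space, `E`-power fibre, large monodromy): the two rational primitive `(3,3)`-classes
`x_i = L_K⁻¹ j_{t*} w_i ∈ P⁶_K(𝒳⁷)` attached to the primitive Weil classes `w₁, w₂` of `E⁶` must be algebraic. Honest status: an instance of
`HC(𝒳)` (and of `A₃(𝒳, K)`), not known to follow from `HC_AV`; nothing minimal; no node; 0 facts.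

References: VoisinHodgeI2002 (§6.2.3 Def. 6.24, Thm. 6.25, Rem. 6.27; §7.1.1–7.1.2; §7.3.2); FultonYoungTableaux1997 (App. B §B.1 (6));
vanGeemen1994HodgeAV (Thm. 6.12); Grothendieck1968 (§3 p. 196).
-/

noncomputable section

set_option linter.dupNamespace false

namespace Summit.HodgeConjecture.HodgeConjecture.Ring2.AbelianAll

open CategoryTheory AlgebraicGeometry
open Literature.AlgebraicGeometry Literature.AlgebraicGeometry.Motives
open Literature.AlgebraicGeometry.HodgeTheory
open Literature.AlgebraicTopology.SingularHomology (singularCohomology cupProduct cupProduct_map)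
open Literature.Geometry.Kaehler (lefschetzOperator lefschetzPow HasHardLefschetzProperty)

section HodgeClasses

variable {𝒳 S : SchemeOver ℂ} {d : ℕ} {f : 𝒳 ⟶ S}

/-- **The hard-Lefschetz preimage `x` of `j_{t*}(L_κᵐ ξ)`, `ξ` `κ`-primitive, is `K`-PRIMITIVE on the total space**: `L_K^{m+2} x =
L_K j_{t*} L_κᵐ ξ = j_{t*} L_κ^{m+1} ξ = 0`. So the fibre-supported clause of part XXIII-f concerns classes in the primitive part
`P^{2p+2}_K(𝒳)` of the `(d+1)`-fold (`2(p+1) + (m+1) = d + 1`). [cite: VoisinHodgeI2002, §6.2.3 Def. 6.24 and Thm. 6.25]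
[cite: FultonYoungTableaux1997, Appendix B §B.1 (6)] -/
theorem hardLefschetz_preimage_fiberGysin_primitive (hf : IsCompactAbelianPencil f d) (t : ComplexPoints S)
    (K : complexBetti 𝒳 2) {p m : ℕ} (hpm : 2 * (p + 1) + m = d) {ξ : complexBetti (fiberOver f t) (2 * (p + 1))}
    (hξP : ξ ∈ primitiveClasses (complexBetti.map (fiberι f t) 2 K) d (2 * (p + 1)))
    {x : complexBetti 𝒳 (2 * (p + 1))}
    (hx : lefschetzPowTo K (m + 1) (2 * (p + 1)) (2 * (p + 1 + m + 1)) (by omega) x =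
      fiberGysin hf t (p + 1 + m) (lefschetzPowTo (complexBetti.map (fiberι f t) 2 K) m (2 * (p + 1)) (2 * (p + 1 + m)) (by omega) ξ)) :
    lefschetzPowTo K (m + 2) (2 * (p + 1)) (2 * (p + 1 + m + 1 + 1)) (by omega) x = 0 := by
  rw [← lefschetzPowTo_lefschetzPowTo K 1 (show 2 * (p + 1) + 2 * (m + 1) = 2 * (p + 1 + m + 1) by omega)
      (show 2 * (p + 1 + m + 1) + 2 * 1 = 2 * (p + 1 + m + 1 + 1) by omega)
      (show 2 * (p + 1) + 2 * (m + 1 + 1) = 2 * (p + 1 + m + 1 + 1) by omega), hx,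
    lefschetzPowTo_fiberGysin hf t K 1 (rfl : p + 1 + m + 1 = p + 1 + m + 1),
    lefschetzPowTo_lefschetzPowTo _ 1 (show 2 * (p + 1) + 2 * m = 2 * (p + 1 + m) by omega)
      (show 2 * (p + 1 + m) + 2 * 1 = 2 * (p + 1 + m + 1) by omega) (show 2 * (p + 1) + 2 * (m + 1) = 2 * (p + 1 + m + 1) by omega),
    lefschetzPowTo_eq_zero_of_mem_primitiveClasses hξP (show 2 * (p + 1) + 2 * (m + 1) = 2 * (p + 1 + m + 1) by omega) (by omega),
    map_zero]

/-- **… and of Hodge type `(p+1, p+1)` when `ξ` is** (e.g. `ξ` algebraic): `j_{t*} L_κᵐ ξ` has no component of type `(a, b)` with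
`a ≠ b` (the diagonal type projectors `T^δ`, `δ ≠ 0`, pass through `L_κᵐ` and `j_{t*}` — part XXIII-a — and kill `ξ`), hence neither has `x`
(they pass through `L_K^{m+1}`, injective). [cite: VoisinHodgeI2002, §6.2.3 Rem. 6.27, §7.1.1 and §7.3.2] -/
theorem hardLefschetz_preimage_fiberGysin_hodgeType (hf : IsCompactAbelianPencil f d) (t : ComplexPoints S)
    (D : KaehlerRationalDatum (d + 1) 𝒳) {p m : ℕ} (hpm : 2 * (p + 1) + m = d)
    {ξ : complexBetti (fiberOver f t) (2 * (p + 1))} (hξT : IsOfHodgeType d (fiberOver f t) (2 * (p + 1)) (p + 1) (p + 1) ξ)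
    {x : complexBetti 𝒳 (2 * (p + 1))}
    (hx : lefschetzPowTo D.Hη (m + 1) (2 * (p + 1)) (2 * (p + 1 + m + 1)) (by omega) x =
      fiberGysin hf t (p + 1 + m)
        (lefschetzPowTo (complexBetti.map (fiberι f t) 2 D.Hη) m (2 * (p + 1)) (2 * (p + 1 + m)) (by omega) ξ)) :
    IsOfHodgeType (d + 1) 𝒳 (2 * (p + 1)) (p + 1) (p + 1) x := by
  classical
  have h𝒳 := hf.isSmoothProjective_total
  have hXt := hf.isSmoothProjective_fiberOver t
  obtain ⟨A⟩ := nonempty_hodgeModel_holds h𝒳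
  obtain ⟨B⟩ := nonempty_hodgeModel_holds hXt
  have hK11 : IsOfHodgeType (d + 1) 𝒳 2 1 1 D.Hη := D.isOfHodgeType_Hη
  have hκ11 : IsOfHodgeType d (fiberOver f t) 2 1 1 (complexBetti.map (fiberι f t) 2 D.Hη) :=
    hK11.map_of_isSmoothProjective hXt h𝒳 (fiberι f t)
  have hL : Function.Injective (lefschetzPowTo D.Hη (m + 1) (2 * (p + 1)) (2 * (p + 1 + m + 1)) (by omega)) :=
    (bijective_lefschetzPowTo_of_hasHardLefschetz D.Hη (isPolarizationClass_Hη h𝒳 D).hasHardLefschetz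
      (by omega : 2 * (p + 1) + (m + 1) = d + 1) _ _).1
  have hpp : (p + 1, p + 1) ∈ Finset.HasAntidiagonal.antidiagonal (2 * (p + 1)) :=
    Finset.HasAntidiagonal.mem_antidiagonal.2 (by omega)
  have hξB : ξ ∈ B.typePiece (2 * (p + 1)) ⟨(p + 1, p + 1), hpp⟩ :=
    B.mem_typePiece_of_isOfHodgeType hodgePQ_independent_of_hodgeModel_holds hXt hpp hξT
  -- the off-diagonal projectors kill `x`
  have hTx : ∀ δ : ℤ, δ ≠ 0 → A.typeProjDiff (2 * (p + 1)) δ x = 0 := by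
    intro δ hδ
    apply hL
    rw [map_zero, ← typeProjDiff_lefschetzPowTo_of_isOfHodgeType h𝒳 A hK11 δ, hx, typeProjDiff_fiberGysin hf t A B,
      typeProjDiff_lefschetzPowTo_of_isOfHodgeType hXt B hκ11 δ,
      typeProjDiff_apply_eq_zero_of_mem B (pq := ⟨(p + 1, p + 1), hpp⟩) (by push_cast; simpa using hδ.symm) hξB,
      map_zero, map_zero]
  -- hence `x = π_{(p+1,p+1)} x`
  set pq₀ : ↥(Finset.HasAntidiagonal.antidiagonal (2 * (p + 1))) := ⟨(p + 1, p + 1), hpp⟩ with hpq₀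
  have hothers : ∀ pq : ↥(Finset.HasAntidiagonal.antidiagonal (2 * (p + 1))), pq ≠ pq₀ → A.typeProj (2 * (p + 1)) pq x = 0 := by
    intro pq hne
    have hpq := Finset.HasAntidiagonal.mem_antidiagonal.1 pq.2
    have hδ : (pq.1.1 : ℤ) - pq.1.2 ≠ 0 := by
      intro h0
      apply hne
      rw [hpq₀]
      exact Subtype.ext (Prod.ext (by simp only; omega) (by simp only; omega))
    rw [← A.typeProjDiff_eq_typeProj pq rfl x]
    exact hTx _ hδ
  have hxeq : A.typeProj (2 * (p + 1)) pq₀ x = x := by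
    have hsum := A.sum_typeProj (2 * (p + 1)) x
    rw [← Finset.add_sum_erase _ _ (Finset.mem_univ pq₀)] at hsum
    rw [Finset.sum_eq_zero (fun pq hpq ↦ hothers pq (Finset.mem_erase.1 hpq).1), add_zero] at hsum
    exact hsum
  have hmem : x ∈ A.typePiece (2 * (p + 1)) pq₀ := by
    rw [← hxeq]
    exact A.typeProj_mem _ _ x
  have h := A.isOfHodgeType_of_mem_typePiece hmem
  rw [hpq₀] at h
  exact h

/-- **… and RATIONAL when `ξ` is**: `j_{t*}` and `L_κᵐ` preserve rational classes, and the hard Lefschetz isomorphism of the rational class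
`D.η` is defined over `ℚ` (`KaehlerRationalDatum.hasHardLefschetzProperty_rat`). With the two previous lemmas: for a RATIONAL `κ`-primitive
invariant algebraic class `ξ` of the fibre, the class `x = (L_K^{m+1})⁻¹ j_{t*} L_κᵐ ξ` is a rational, `K`-primitive Hodge class of type
`(p+1, p+1)` on the total space — the fibre-supported clause of part XXIII-f asks exactly that these explicit primitive Hodge classes of `𝒳` be
algebraic (an instance of the Hodge conjecture for the `(d+1)`-fold `𝒳`). [cite: VoisinHodgeI2002, §7.1.2 and Thm. 6.25] [cite: VoisinHodgeI2002, §7.3.2] -/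
theorem hardLefschetz_preimage_fiberGysin_rational (hf : IsCompactAbelianPencil f d) (t : ComplexPoints S)
    (D : KaehlerRationalDatum (d + 1) 𝒳) {p m : ℕ} (hpm : 2 * (p + 1) + m = d)
    {ξ : complexBetti (fiberOver f t) (2 * (p + 1))} (hξQ : IsRationalClass ξ) {x : complexBetti 𝒳 (2 * (p + 1))}
    (hx : lefschetzPowTo D.Hη (m + 1) (2 * (p + 1)) (2 * (p + 1 + m + 1)) (by omega) x =
      fiberGysin hf t (p + 1 + m)
        (lefschetzPowTo (complexBetti.map (fiberι f t) 2 D.Hη) m (2 * (p + 1)) (2 * (p + 1 + m)) (by omega) ξ)) :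
    IsRationalClass x := by
  have h𝒳 := hf.isSmoothProjective_total
  have hXt := hf.isSmoothProjective_fiberOver t
  have hL : Function.Injective (lefschetzPowTo D.Hη (m + 1) (2 * (p + 1)) (2 * (p + 1 + m + 1)) (by omega)) :=
    (bijective_lefschetzPowTo_of_hasHardLefschetz D.Hη (isPolarizationClass_Hη h𝒳 D).hasHardLefschetz
      (by omega : 2 * (p + 1) + (m + 1) = d + 1) _ _).1
  -- the right-hand side is rational
  have hyQ : IsRationalClass (fiberGysin hf t (p + 1 + m)
      (lefschetzPowTo (complexBetti.map (fiberι f t) 2 D.Hη) m (2 * (p + 1)) (2 * (p + 1 + m)) (by omega) ξ)) :=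
    isRationalClass_complexGysin_complexOrientationFamily hXt h𝒳 (fiberι f t) _
      ((D.isRationalClass_Hη.map _).lefschetzPowTo m _ _ _ hξQ)
  obtain ⟨y₀, hy₀⟩ := (isRationalClass_iff_mem_range_ofRatClass _).1 hyQ
  -- the rational hard Lefschetz preimage
  obtain ⟨x₀, hx₀⟩ := (bijective_lefschetzPowTo_of_hasHardLefschetz D.η (D.hasHardLefschetzProperty_rat h𝒳)
    (by omega : 2 * (p + 1) + (m + 1) = d + 1) (2 * (p + 1 + m + 1)) (by omega)).2 y₀
  have hxx₀ : x = ofRatClass _ _ x₀ := by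
    apply hL
    rw [hx, ← hy₀, ← hx₀, ofRatClass_eq_ringChange, ofRatClass_eq_ringChange,
      ringChange_lefschetzPowTo_of_eq (algebraMap ℚ ℂ) D.ringChange_eq]
  rw [hxx₀]
  exact isRationalClass_ofRatClass _

end HodgeClasses

end Summit.HodgeConjecture.HodgeConjecture.Ring2.AbelianAll

end
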